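import Literature.Claims.NS.Zhirkin2016
import HarnessLib

/-!
# C82 `Jackson2022` — typed skeleton (cell `ns-claims`, D-0090 NS-CLAIMS SWEEP; T3 QUICK TRANCHE, statement grain)

R. L. Jackson, «The Utilization of the Generating Function Technique in the Discovery of Solutions for
the Three-Dimensional Navier-Stokes Equation System», Open Journal of Fluid Dynamics 12 (2022) 86–95,
doi:10.4236/ojfd.2022.121005 [cite: Jackson2022]. Version typed: the journal PDF (print pp.86–95),
`pub/ns-claims/sources/Jackson2022/` (PDF sha256[:16] d42d5fd93c573061, text, LOCATORS by lit-1 g2).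
Card `pub/ns-claims/claims/Jackson2022/CARD.md` (PREDICTION registered 2026-08-27T01:37:33Z, before any
body page was opened). Locators = print page + equation/lemma number.

STRUCTURE OF THE PRINT. §3 «GFT» (a truncated exponential-series ansatz `u_g`); §4.1 Prop. 4.1.1 p.89
«The general solution u_g of the GFT can be used to derive putative exact solutions of the velocity
vector field v and internal pressure p to NSEs with and without an external force f»; for `f = 0` the
displayed field (4.1.16)–(4.1.17) p.92 (`v416`, `p417` below — a scalar plane wave `S` times the fixed
direction `(1, β₂/κ, β₃/κ)`, `κ` standing for the printed radical `√(−β₂²−β₃²)`); §4.2 Lemma 4.2.1 p.92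
(smoothness: «linear combinations of C∞ functions (i.e. e^{±ax}) … therefore, they are likely C∞
functions themselves» p.93), Lemma 4.2.2 p.93 + (4.2.1)–(4.2.2) (kinetic energy `E ≥ ∫₀^∞∫₀^∞∫₀^∞ |v|²`
— an octant integral as printed) with p.94 «The kinetic energy for the NSEs without external force f
is zero», Theorem 4.2.3 p.94 and the Conclusion p.94 (`ClaimedTheorem`, `ClaimedNegativeForced`).

WHAT THE KERNEL RECORDS HERE (structural, no verdict): (1) `no_real_printedRadical` — for REAL
parameters the printed radical `κ = √(−β₂²−β₃²)` with the printed non-zero denominators `2c₂`,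
`2√(−β₂²−β₃²)c₂` has no instance (κ² = −(β₂²+β₃²) forces β₂ = β₃ = κ = 0): the displayed (4.1.16) is
not a real-valued field for any admissible parameter choice (F15), so every Step quantified over
admissible real parameters is VACUOUSLY true; (2) `claimedTheorem_holds` — the Conclusion's unforced
sentence, read literally (∃ a smooth unforced solution with zero kinetic energy), is witnessed by the
rest state (tree `isNavierStokesSolution_zero`); (3) `step_bridge_iff_clayA` — the printed passage «In
other words, both the Millennium prize criteria are satisfied» (`Step_bridge`) is therefore EQUIVALENT
to Fefferman's (A) itself (Δ4/Δ6: one exhibited field vs every datum of class (4)). The forced negative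
sentence `ClaimedNegativeForced` is typed as printed and left to the refuter.

CLAY DELTA (vs `ClayVariants.clayR3`, Fefferman (A) [FeffermanClay2006]): Δ6 FORM/Δ4 DATA — an ∃-statement
about ONE derived field (no quantifier over initial data anywhere in the print; «The initial condition
v₀ can be derived from the putative exact solution … by setting time t equal to zero» p.92); Δ5 — the
displayed field is complex-valued for (β₂,β₃) ≠ 0; the energy integral (4.2.1) is over the first octant,
not ℝ³; Δ1 ℝ³ (=). Not load-bearing for the typed Steps; recorded in `Step_bridge`.

WHAT THIS IS NOT: not a claim about NS regularity or blow-up; not a claim about any author beyond the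
typed locator.
-/

open scoped ContDiff
open _root_.MeasureTheory _root_.Set Function

namespace Literature.Claims.NS.Jackson2022

open Literature.Analysis.FluidPDE Literature.Claims.NS.ClayVariants

/-- `ℝ³` (plumbing abbreviation). [folklore] -/
abbrev E3 := EuclideanSpace ℝ (Fin 3)

/-! ## The displayed field (4.1.16)–(4.1.17), p.92 -/

/-- The real parameters of the display (4.1.16)–(4.1.17): `A = a1(1,−1) + a1(2,−1)`,
`D = a1(1,−1) − a1(2,−1)`, `c₂`, `α`, `β₂`, `β₃`, the density `ρ`, and `κ`, which stands for the printed
radical `√(−β₂² − β₃²)` (its defining relation is `PrintedRadical`). [cite: Jackson2022, (4.1.16)–(4.1.17) p.92] -/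
structure Params where
  /-- `a1(1,−1) + a1(2,−1)`. -/
  A : ℝ
  /-- `a1(1,−1) − a1(2,−1)`. -/
  D : ℝ
  /-- `c₂` (from (4.1.2) `φ(ξ) = c₁e^{ξ} + c₂e^{−ξ}`). -/
  c₂ : ℝ
  /-- The time rate `α`. -/
  α : ℝ
  /-- The printed radical `√(−β₂² − β₃²)` (coefficient of `x` in the exponent). -/
  κ : ℝ
  /-- `β₂` (coefficient of `y`). -/
  β₂ : ℝ
  /-- `β₃` (coefficient of `z`). -/
  β₃ : ℝ
  /-- The density `ρ` of (2.1). -/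
  ρ : ℝ

/-- What the printed symbol `√(−β₂² − β₃²)` asserts of the real number `κ`: `κ² = −(β₂² + β₃²)` (and
`κ ≥ 0`, not needed). [cite: Jackson2022, (4.1.16) p.92] -/
def Params.PrintedRadical (P : Params) : Prop := P.κ ^ 2 = -(P.β₂ ^ 2 + P.β₃ ^ 2)

/-- The printed denominators `2c₂` and `2√(−β₂²−β₃²)c₂` of (4.1.16)–(4.1.17) are non-zero.
[cite: Jackson2022, (4.1.16)–(4.1.17) p.92] -/
def Params.DenomsNonzero (P : Params) : Prop := P.c₂ ≠ 0 ∧ P.κ ≠ 0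

/-- The exponent `αt + √(−β₂²−β₃²)x + β₂y + β₃z`. [cite: Jackson2022, (4.1.16) p.92] -/
def phase (P : Params) (t : ℝ) (q : E3) : ℝ := P.α * t + P.κ * q 0 + P.β₂ * q 1 + P.β₃ * q 2

/-- The scalar wave `S = A·e^{phase} + c₂²D·e^{−phase}` common to all four displayed components.
[cite: Jackson2022, (4.1.16)–(4.1.17) p.92] -/
noncomputable def S (P : Params) (t : ℝ) (q : E3) : ℝ :=
  P.A * Real.exp (phase P t q) + P.c₂ ^ 2 * P.D * Real.exp (-phase P t q)

/-- The fixed direction `(1/(2c₂)) · (1, β₂/κ, β₃/κ)` of (4.1.16). [cite: Jackson2022, (4.1.16) p.92] -/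
noncomputable def dir (P : Params) : E3 :=
  (1 / (2 * P.c₂)) • (EuclideanSpace.single 0 1 + (P.β₂ / P.κ) • EuclideanSpace.single 1 1 +
    (P.β₃ / P.κ) • EuclideanSpace.single 2 1)

/-- The displayed velocity field (4.1.16): `v = S · dir`, i.e.
`v₁ = (A e^{E} + c₂²D e^{−E})/(2c₂)`, `v₂ = β₂(…)/(2κc₂)`, `v₃ = β₃(…)/(2κc₂)`, `E = phase`.
[cite: Jackson2022, (4.1.16) p.92] -/
noncomputable def v416 (P : Params) (t : ℝ) (q : E3) : E3 := S P t q • dir P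

/-- The displayed pressure (4.1.17): `p = −αρ (A e^{E} + c₂²D e^{−E})/(2c₂κ)` (the radical is printed
there as `√(−β₂ − β₃²)`, read as the same `κ`). [cite: Jackson2022, (4.1.17) p.92] -/
noncomputable def p417 (P : Params) (t : ℝ) (q : E3) : ℝ := -(P.α * P.ρ * S P t q / (2 * P.c₂ * P.κ))

/-- **F15 record (well-definedness of the displayed object over ℝ).** No real parameter tuple satisfies
the printed radical relation together with the printed non-zero denominators: `κ² = −(β₂²+β₃²) ≥ 0`
forces `β₂ = β₃ = 0`, hence `κ = 0`. So (4.1.16)–(4.1.17) is not a real-valued field for any admissible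
choice (for `(β₂,β₃) ≠ 0` the print's `√(−β₂²−β₃²)` is imaginary). [cite: Jackson2022, (4.1.16) p.92] -/
theorem no_real_printedRadical : ¬ ∃ P : Params, P.PrintedRadical ∧ P.DenomsNonzero := by
  rintro ⟨P, hr, -, hκ⟩
  have h1 : 0 ≤ P.κ ^ 2 := sq_nonneg _
  have h2 : 0 ≤ P.β₂ ^ 2 + P.β₃ ^ 2 := by positivity
  have h3 : P.κ ^ 2 = 0 := by rw [Params.PrintedRadical] at hr; linarith
  exact hκ (pow_eq_zero_iff (two_ne_zero) |>.mp h3)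

/-! ## The printed checks of §4.1–§4.2 as Steps (each quantified over admissible REAL parameters —
vacuous by `no_real_printedRadical`; typed for the record, not verdicts) -/

/-- **Prop. 4.1.1 / (4.1.16)–(4.1.17) p.89, p.92** — «putative exact solutions of the velocity vector
field v and internal pressure p to NSEs … without an external force»: for admissible parameters the
display solves the unforced system (1)–(3) (tree `IsNavierStokesSolution`, datum = the display at
`t = 0`, «by setting time t equal to zero» p.92). [cite: Jackson2022, Prop. 4.1.1 p.89; (4.1.16) p.92] -/
def Step_P411_solves : Prop :=
  ∀ P : Params, P.PrintedRadical → P.DenomsNonzero → ∀ ν : ℝ, 0 < ν →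
    IsNavierStokesSolution ν 0 (v416 P 0) (v416 P) (p417 P)

/-- **Lemma 4.2.1 p.92–93** — «both sets of velocity vector fields v and the internal pressures p are
linear combinations of C∞ functions … therefore, they are likely C∞ functions themselves»: smoothness
on `ℝ³ × [0,∞)` (tree `IsSmoothOnHalfSpace`). [cite: Jackson2022, Lemma 4.2.1 p.92, p.93 ¶1] -/
def Step_L421_smooth : Prop :=
  ∀ P : Params, P.DenomsNonzero → IsSmoothOnHalfSpace (v416 P) ∧ IsSmoothOnHalfSpace (p417 P)

/-- The first octant `(0,∞)³`, the printed integration range of (4.2.1). [cite: Jackson2022, (4.2.1) p.93] -/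
def octant : Set E3 := {q | ∀ i, 0 < q i}

/-- The printed kinetic energy (4.2.1)–(4.2.2): `∫₀^∞∫₀^∞∫₀^∞ |v(x,y,z,t)|² dz dy dx` (over the first
octant, as printed; Fefferman's (7) integrates over ℝ³). [cite: Jackson2022, (4.2.1)–(4.2.2) p.93–94] -/
noncomputable def kineticEnergy (u : ℝ → E3 → E3) (t : ℝ) : ℝ := ∫ q in octant, ‖u t q‖ ^ 2

/-- **Lemma 4.2.2 / p.94 l.1–2** — «The kinetic energy for the NSEs without external force f is zero»:
for admissible parameters the display (4.1.16) has zero kinetic energy at all times.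
[cite: Jackson2022, Lemma 4.2.2 p.93; p.94 l.1–2] -/
def Step_L422_energyZero : Prop :=
  ∀ P : Params, P.PrintedRadical → P.DenomsNonzero → ∀ t : ℝ, 0 ≤ t → kineticEnergy (v416 P) t = 0

/-- The Steps over admissible real parameters hold VACUOUSLY (no admissible tuple exists,
`no_real_printedRadical`) — kernel record that they carry no content. [cite: Jackson2022, §4 pp.89–94] -/
theorem steps_vacuous : Step_P411_solves ∧ Step_L422_energyZero :=
  ⟨fun P hr hd => absurd ⟨P, hr, hd⟩ no_real_printedRadical,
    fun P hr hd => absurd ⟨P, hr, hd⟩ no_real_printedRadical⟩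

/-! ## The claimed statements (Theorem 4.2.3 and Conclusion, p.94) -/

/-- **CLAIMED THEOREM (unforced half of Thm 4.2.3 + Conclusion p.94, read literally):** «If an external
force is lacking in the NSEs, the velocity vector field v and the internal pressure p are both smooth
… C∞ functions. Also, the kinetic energy of the velocity profile for this system is zero, which is less
than some constant E; thus, the kinetic energy is globally bound for the system.» — for every `ν > 0`
there are a datum and a smooth unforced solution on `ℝ³ × [0,∞)` whose kinetic energy vanishes at all
times. [cite: Jackson2022, Thm 4.2.3 p.94; Conclusion p.94] -/
def ClaimedTheorem : Prop :=
  ∀ ν : ℝ, 0 < ν → ∃ (u₀ : E3 → E3) (u : ℝ → E3 → E3) (p : ℝ → E3 → ℝ),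
    IsSmoothOnHalfSpace u ∧ IsSmoothOnHalfSpace p ∧ IsNavierStokesSolution ν 0 u₀ u p ∧
      ∀ t : ℝ, 0 ≤ t → kineticEnergy u t = 0

/-- **KERNEL RECORD: the claimed sentence holds — witnessed by the rest state** `u ≡ 0`, `p ≡ 0`
(tree `isNavierStokesSolution_zero`); indeed zero kinetic energy forces a continuous `v` to vanish on
the octant, so nothing but (octant-)trivial fields can witness it. [cite: Jackson2022, Conclusion p.94] -/
theorem claimedTheorem_holds : ClaimedTheorem := by
  intro ν _
  obtain ⟨hns, hsu, hsp⟩ := isNavierStokesSolution_zero (E := E3) ν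
  exact ⟨0, 0, 0, hsu, hsp, hns, fun t _ => by simp [kineticEnergy]⟩

/-- **CLAIMED NEGATIVE SENTENCE (forced half of Thm 4.2.3 + Conclusion p.94):** «the method failed to
generate valid solutions … for NSEs with external force f» / «there are no velocity vector fields v,
under an external force f, that can satisfy both criteria set by the Clay Mathematics Institute» —
for every `ν > 0` and every smooth, not identically zero force there is NO smooth bounded-energy
solution (criteria (6)–(7)). Typed as printed; left to the refuter. [cite: Jackson2022, Thm 4.2.3 p.94; Conclusion p.94] -/
def ClaimedNegativeForced : Prop :=
  ∀ ν : ℝ, 0 < ν → ∀ f : ℝ → E3 → E3, IsSmoothOnHalfSpace f → (∃ t, 0 ≤ t ∧ ∃ x, f t x ≠ 0) →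
    ¬ ∃ (u₀ : E3 → E3) (u : ℝ → E3 → E3) (p : ℝ → E3 → ℝ),
      IsSmoothOnHalfSpace u ∧ IsSmoothOnHalfSpace p ∧ IsNavierStokesSolution ν f u₀ u p ∧
        HasBoundedEnergy u

/-! ## Clay link -/

/-- **The bridge p.94** — «In other words, both the Millennium prize criteria are satisfied»: from the
claimed sentence to Fefferman's (A) (`ClayVariants.clayR3.Regularity`: EVERY smooth divergence-free
datum of class (4) has a smooth bounded-energy solution). This is the Δ4/Δ6 passage (one exhibited
field vs all data); a `Prop`, not asserted. [cite: Jackson2022, Conclusion p.94; FeffermanClay2006, (A) p.2] -/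
def Step_bridge : Prop := ClaimedTheorem → clayR3.Regularity

/-- **KERNEL RECORD: the bridge IS Fefferman's (A)** (since the claimed sentence holds trivially) — the
printed «in other words» carries the whole Millennium problem. [cite: Jackson2022, Conclusion p.94] -/
theorem step_bridge_iff_clayA : Step_bridge ↔ clayR3.Regularity :=
  ⟨fun h => h claimedTheorem_holds, fun h _ => h⟩

/-- Composition as printed: claimed sentence + bridge ⇒ (A). [cite: Jackson2022, Conclusion p.94] -/
theorem clayA_of_bridge (h : Step_bridge) : clayR3.Regularity := h claimedTheorem_holds

/-! ## D-0026 in-file discharges (APPEND-ONLY; ns-claims debt pass, typist-7 g6, 2026-08-27)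

Named kernel certificates for the statement-based debt census. The two Steps quantified over
admissible REAL parameters hold VACUOUSLY (`no_real_printedRadical`; already recorded jointly as
`steps_vacuous`), and Lemma 4.2.1 as typed — smoothness of the display (4.1.16)–(4.1.17) for `c₂ ≠ 0`,
`κ ≠ 0` — holds because the display is a polynomial–exponential expression in a phase affine in `(t, x)`.
Nothing above is touched: no statement, no locator (`ClaimedNegativeForced`, #74), no class. -/

/-- **Prop. 4.1.1 as typed HOLDS — vacuously**: there is no admissible real parameter tuple
(`no_real_printedRadical`); named twin of `steps_vacuous.1`. [cite: Jackson2022, Prop. 4.1.1 p.89; (4.1.16) p.92] -/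
theorem step_P411_solves_holds : Step_P411_solves := steps_vacuous.1

/-- `Step_P411_solves` — `_holds` alias of `step_P411_solves_holds` above under the fact's exact name (appended
2026-08-28, D-0026 bookkeeping: the proof term is the existing theorem of this file; no statement,
definition or attribute is edited; no new named fact; the ledger's debt table listed the fact
unproved). [cite: Jackson2022, Prop. 4.1.1 p.89; (4.1.16) p.92] -/
theorem _root_.Literature.Claims.NS.Jackson2022.Step_P411_solves_holds : Step_P411_solves :=
  _root_.Literature.Claims.NS.Jackson2022.step_P411_solves_holds

/-- **Lemma 4.2.2 as typed HOLDS — vacuously** (named twin of `steps_vacuous.2`).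
[cite: Jackson2022, Lemma 4.2.2 p.93; p.94 l.1–2] -/
theorem step_L422_energyZero_holds : Step_L422_energyZero := steps_vacuous.2

/-- `Step_L422_energyZero` — `_holds` alias of `step_L422_energyZero_holds` above under the fact's exact name (appended
2026-08-28, D-0026 bookkeeping: the proof term is the existing theorem of this file; no statement,
definition or attribute is edited; no new named fact; the ledger's debt table listed the fact
unproved). [cite: Jackson2022, Lemma 4.2.2 p.93; p.94 l.1–2] -/
theorem _root_.Literature.Claims.NS.Jackson2022.Step_L422_energyZero_holds : Step_L422_energyZero :=
  _root_.Literature.Claims.NS.Jackson2022.step_L422_energyZero_holds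

/-- The exponent `αt + κx + β₂y + β₃z` is jointly `C^∞` in `(t, (x,y,z))`. [cite: Jackson2022, (4.1.16) p.92] -/
theorem contDiff_uncurry_phase (P : Params) : ContDiff ℝ ∞ (uncurry (phase P)) := by
  have hc : ∀ i : Fin 3, ContDiff ℝ ∞ fun z : ℝ × E3 => z.2 i := fun i =>
    (EuclideanSpace.proj i : E3 →L[ℝ] ℝ).contDiff.comp contDiff_snd
  have h : uncurry (phase P) =
      fun z : ℝ × E3 => P.α * z.1 + P.κ * z.2 0 + P.β₂ * z.2 1 + P.β₃ * z.2 2 := by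
    funext z; rfl
  rw [h]
  exact (((contDiff_const.mul contDiff_fst).add (contDiff_const.mul (hc 0))).add
    (contDiff_const.mul (hc 1))).add (contDiff_const.mul (hc 2))

/-- The scalar wave `S = A e^{phase} + c₂²D e^{−phase}` is jointly `C^∞`. [cite: Jackson2022, (4.1.16) p.92] -/
theorem contDiff_uncurry_S (P : Params) : ContDiff ℝ ∞ (uncurry (S P)) := by
  have hφ := contDiff_uncurry_phase P
  have h : uncurry (S P) = fun z : ℝ × E3 =>
      P.A * Real.exp (uncurry (phase P) z) + P.c₂ ^ 2 * P.D * Real.exp (-uncurry (phase P) z) := by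
    funext z; rfl
  rw [h]
  exact (contDiff_const.mul hφ.exp).add (contDiff_const.mul hφ.neg.exp)

/-- **Lemma 4.2.1 as typed HOLDS**: for `c₂ ≠ 0`, `κ ≠ 0` (indeed for all real parameters) the displayed
velocity (4.1.16) and pressure (4.1.17) are `C^∞` on `ℝ × ℝ³`, hence smooth on the closed half-space
`[0,∞) × ℝ³` (`IsSmoothOnHalfSpace`). The printed «likely C∞» is a theorem for the display as typed
(which, over ℝ, never meets the printed radical — `no_real_printedRadical`).
[cite: Jackson2022, Lemma 4.2.1 p.92, p.93 ¶1] -/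
theorem step_L421_smooth_holds : Step_L421_smooth := by
  intro P _
  have hS := contDiff_uncurry_S P
  have hv : ContDiff ℝ ∞ (uncurry (v416 P)) := by
    have h : uncurry (v416 P) = fun z : ℝ × E3 => uncurry (S P) z • dir P := by
      funext z; rfl
    rw [h]
    exact hS.smul contDiff_const
  have hp : ContDiff ℝ ∞ (uncurry (p417 P)) := by
    have h : uncurry (p417 P) =
        fun z : ℝ × E3 => -(P.α * P.ρ * uncurry (S P) z / (2 * P.c₂ * P.κ)) := by
      funext z; rfl
    rw [h]
    exact ((contDiff_const.mul hS).div_const _).neg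
  exact ⟨hv.contDiffOn, hp.contDiffOn⟩

/-- `Step_L421_smooth` — `_holds` alias of `step_L421_smooth_holds` above under the fact's exact name (appended
2026-08-28, D-0026 bookkeeping: the proof term is the existing theorem of this file; no statement,
definition or attribute is edited; no new named fact; the ledger's debt table listed the fact
unproved). [cite: Jackson2022, Lemma 4.2.1 p.92, p.93 ¶1] -/
theorem _root_.Literature.Claims.NS.Jackson2022.Step_L421_smooth_holds : Step_L421_smooth :=
  _root_.Literature.Claims.NS.Jackson2022.step_L421_smooth_holds

end Literature.Claims.NS.Jackson2022
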